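import Mathlib
import Summits.ValiantsHypothesis.ValiantsHypothesis.Theorems.RigidityForcesSymmetryRankRigidMinimalReprLaplaceFiveFourSlices
import Summits.ValiantsHypothesis.ValiantsHypothesis.Theorems.RigidityForcesSymmetryRankRigidMinimalReprLaplaceFiveFourSlicesBasis

/-!
# `LaplaceOptimalFive`, slice classes `a = 4`: every slot labelling (four slices + one pair term ≠ P₅)
# (crux `RankRigidMinimalRepr`, stmt-ValiantsHypothesis-18034; frontier rung `LaplaceOptimalFive`, stmt-24813)

`four_slices_one_pair_all`: for ARBITRARY slots `i : Fin 4 → Fin 5` of the four slices and ANY pair cut `{p, q}`,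
the `5 × 5` permutation pattern is not `Σ_k α_k(v_{i k}) W_k(v) + u(v_p, v_q) w(v)` — no order hypothesis left.
The certificate is found by two kernel searches over the multiplicity vectors (`decide +kernel`):
* `plain_order_search` — if some slot outside the pair cut carries no slice, a triangular order exists
  (`four_slices_one_pair`);
* `basis_order_search` — otherwise (the two exceptional shapes) an order exists whose first slot is a slice-free pair
  endpoint and whose last slot carries exactly one slice, valid for `four_slices_one_pair_basis` with the bonus at the
  last slot, AND such that moving that last slice to the second slot gives a triangular order — used when the last
  slice vector vanishes identically (then the slice is relocated with a zero cofactor).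

HONEST FRAMING: an exact partial result toward the frontier rung `LaplaceOptimalFive` (stmt-24813): together with the
format bookkeeping (not in this file) it says a cheap split-rank-one decomposition of `P₅` has at most three slices.
The item stays OPEN; nothing here bears on `VP ≠ VNP`.
-/

set_option autoImplicit false

-- the mandated summit-side namespace repeats a component by design (single-problem summit)
set_option linter.dupNamespace false

namespace Summit.ValiantsHypothesis.ValiantsHypothesis.Theorems.RigidityForcesSymmetryRankRigidMinimalRepr

namespace LaplaceFiveSlices

open Finset

/-! ### §1 The two kernel searches (multiplicity vectors `k : Fin 5 → Fin 5`, `Σ k = 4`) -/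

/-- PLAIN SHAPES: a slice-free slot outside the pair cut ⇒ a triangular order (either orientation of the pair). -/
theorem plain_order_search : ∀ (k : Fin 5 → Fin 5) (p q : Fin 5), p ≠ q → (k 0 : ℕ) + k 1 + k 2 + k 3 + k 4 = 4 →
    (∃ f : Fin 5, f ≠ p ∧ f ≠ q ∧ k f = 0) →
    ∃ ord : Equiv.Perm (Fin 5),
      (ord.symm p < ord.symm q ∧ ∀ j : Fin 5, (k (ord j) : ℕ) + (if ord j = q then 1 else 0) + j + 1 ≤ 5) ∨
      (ord.symm q < ord.symm p ∧ ∀ j : Fin 5, (k (ord j) : ℕ) + (if ord j = p then 1 else 0) + j + 1 ≤ 5) := by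
  decide +kernel

/-- BASIS SHAPES: no slice-free slot outside the pair cut ⇒ an order with: first slot slice-free and a pair endpoint,
last slot outside the cut with exactly one slice, the middle counts valid, and — after moving one slice from the last
slot to the second slot — all counts valid for the plain lemma. -/
theorem basis_order_search : ∀ (k : Fin 5 → Fin 5) (p q : Fin 5), p ≠ q → (k 0 : ℕ) + k 1 + k 2 + k 3 + k 4 = 4 →
    (¬ ∃ f : Fin 5, f ≠ p ∧ f ≠ q ∧ k f = 0) →
    ∃ ord : Equiv.Perm (Fin 5), k (ord 0) = 0 ∧ (k (ord 4) : ℕ) = 1 ∧ ord 4 ≠ p ∧ ord 4 ≠ q ∧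
      ((ord 0 = p ∧ (∀ j : Fin 5, 0 < (j : ℕ) → (j : ℕ) < 4 →
          (k (ord j) : ℕ) + (if ord j = q then 1 else 0) + j + 1 ≤ 5) ∧
        (∀ j : Fin 5, (k (ord j) : ℕ) + (if j = 1 then 1 else 0) - (if j = 4 then 1 else 0) +
          (if ord j = q then 1 else 0) + j + 1 ≤ 5)) ∨
       (ord 0 = q ∧ (∀ j : Fin 5, 0 < (j : ℕ) → (j : ℕ) < 4 →
          (k (ord j) : ℕ) + (if ord j = p then 1 else 0) + j + 1 ≤ 5) ∧
        (∀ j : Fin 5, (k (ord j) : ℕ) + (if j = 1 then 1 else 0) - (if j = 4 then 1 else 0) +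
          (if ord j = p then 1 else 0) + j + 1 ≤ 5))) := by
  decide +kernel

/-! ### §2 Relocating one slice: multiplicities -/

/-- Multiplicities after relocating the slice `ks` to the slot `x`: `#{k : i' k = s} + [i ks = s] = #{k : i k = s} + [x = s]`. -/
theorem card_filter_update (i : Fin 4 → Fin 5) (ks : Fin 4) (x s : Fin 5) :
    (univ.filter (fun k => Function.update i ks x k = s)).card + (if i ks = s then 1 else 0) =
      (univ.filter (fun k => i k = s)).card + (if x = s then 1 else 0) := by
  classical
  rw [card_filter, card_filter, ← add_sum_erase univ _ (mem_univ ks), ← add_sum_erase univ _ (mem_univ ks),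
    Function.update_self]
  have : ∑ k ∈ univ.erase ks, (if Function.update i ks x k = s then 1 else 0) =
      ∑ k ∈ univ.erase ks, (if i k = s then 1 else 0) :=
    sum_congr rfl fun k hk => by rw [Function.update_of_ne (ne_of_mem_erase hk)]
  rw [this]
  ring

/-! ### §3 Every labelling -/

/-- **Four slices + one pair term ≠ P₅, for every slot labelling.**  For any slots `i : Fin 4 → Fin 5` of the slices
(vectors `α_k`, cofactors `W_k` blind to slot `i k`, all arbitrary) and any pair cut `p ≠ q` (factors `u(v_p,v_q)`, `w`
blind to `p, q`, arbitrary): the pattern `[v injective]` is not `Σ_k α_k(v_{i k}) W_k(v) + u(v) w(v)`. -/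
theorem four_slices_one_pair_all (i : Fin 4 → Fin 5) (α : Fin 4 → Fin 5 → ℂ) (W : Fin 4 → (Fin 5 → Fin 5) → ℂ)
    (hW : ∀ k, ∀ v v' : Fin 5 → Fin 5, (∀ j, j ≠ i k → v j = v' j) → W k v = W k v')
    (p q : Fin 5) (hpq : p ≠ q) (u w : (Fin 5 → Fin 5) → ℂ)
    (hu : ∀ v v' : Fin 5 → Fin 5, v p = v' p → v q = v' q → u v = u v')
    (hw : ∀ v v' : Fin 5 → Fin 5, (∀ j, j ≠ p → j ≠ q → v j = v' j) → w v = w v') :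
    ¬ ∀ v : Fin 5 → Fin 5,
      (if Function.Injective v then (1 : ℂ) else 0) = (∑ k, α k (v (i k)) * W k v) + u v * w v := by
  classical
  intro H
  -- multiplicities
  have hcard : ∀ s, (univ.filter (fun k => i k = s)).card ≤ 4 := fun s =>
    (card_filter_le _ _).trans (by simp)
  let kf : Fin 5 → Fin 5 := fun s => ⟨(univ.filter (fun k => i k = s)).card, by have := hcard s; omega⟩
  have hkf : ∀ s, (kf s : ℕ) = (univ.filter (fun k => i k = s)).card := fun s => rfl
  have hsum : (kf 0 : ℕ) + kf 1 + kf 2 + kf 3 + kf 4 = 4 := by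
    have h := Finset.card_eq_sum_card_fiberwise (s := (univ : Finset (Fin 4))) (t := (univ : Finset (Fin 5)))
      (f := i) (fun _ _ => mem_univ _)
    rw [card_univ, Fintype.card_fin, Fin.sum_univ_five] at h
    simp only [hkf]
    omega
  -- the pair hypotheses with `p, q` swapped
  have hu' : ∀ v v' : Fin 5 → Fin 5, v q = v' q → v p = v' p → u v = u v' := fun v v' h1 h2 => hu v v' h2 h1
  have hw' : ∀ v v' : Fin 5 → Fin 5, (∀ j, j ≠ q → j ≠ p → v j = v' j) → w v = w v' :=
    fun v v' h => hw v v' (fun j hjp hjq => h j hjq hjp)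
  by_cases hfree : ∃ f : Fin 5, f ≠ p ∧ f ≠ q ∧ kf f = 0
  · -- PLAIN shapes
    obtain ⟨ord, hord⟩ := plain_order_search kf p q hpq hsum hfree
    rcases hord with ⟨hlt, hc⟩ | ⟨hlt, hc⟩
    · exact four_slices_one_pair i α W hW p q u w hu hw ord hlt hc H
    · exact four_slices_one_pair i α W hW q p u w hu' hw' ord hlt hc H
  · -- BASIS shapes
    obtain ⟨ord, h0, h4, h4p, h4q, hrest⟩ := basis_order_search kf p q hpq hsum hfree
    have hone : (univ.filter (fun k => i k = ord 4)).card = 1 := by rw [← hkf]; exact h4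
    obtain ⟨ks, hks⟩ := Finset.card_eq_one.mp hone
    have hiks : i ks = ord 4 := by
      have : ks ∈ univ.filter (fun k => i k = ord 4) := by rw [hks]; exact mem_singleton_self ks
      simpa using this
    have hnone : ∀ k, i k ≠ ord 0 := by
      intro k hk
      have : (univ.filter (fun k => i k = ord 0)).card = 0 := by rw [← hkf, h0]; rfl
      rw [Finset.card_eq_zero, filter_eq_empty_iff] at this
      exact this (mem_univ k) hk
    -- `p` (resp. `q`) is the first slot: orientation
    have horient : ∀ a c : Fin 5, a ≠ c → ord 0 = a → ord.symm a < ord.symm c := by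
      intro a c hac h0a
      have e1 : ord.symm a = 0 := by rw [← h0a, Equiv.symm_apply_apply]
      rw [e1, Fin.lt_def]
      apply Nat.pos_of_ne_zero
      intro hz
      apply hac
      have : ord.symm c = 0 := Fin.ext hz
      rw [← e1] at this
      exact (ord.symm.injective this).symm
    have hjq : ∀ j : Fin 5, ord j = ord 1 ↔ j = 1 := fun j => ord.injective.eq_iff
    have hj4 : ∀ j : Fin 5, ord j = ord 4 ↔ j = 4 := fun j => ord.injective.eq_iff
    by_cases hα : α ks = 0
    · -- degenerate: the slice at the last slot vanishes; relocate it to the second slot with a zero cofactor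
      let i' : Fin 4 → Fin 5 := Function.update i ks (ord 1)
      let W' : Fin 4 → (Fin 5 → Fin 5) → ℂ := Function.update W ks 0
      have hW' : ∀ k, ∀ v v' : Fin 5 → Fin 5, (∀ j, j ≠ i' k → v j = v' j) → W' k v = W' k v' := by
        intro k v v' hvv'
        by_cases hk : k = ks
        · subst hk; simp [W']
        · simp only [W', i', Function.update_of_ne hk] at hvv' ⊢
          exact hW k v v' hvv'
      have H' : ∀ v : Fin 5 → Fin 5,
          (if Function.Injective v then (1 : ℂ) else 0) = (∑ k, α k (v (i' k)) * W' k v) + u v * w v := by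
        intro v
        rw [H v]
        congr 1
        refine Fintype.sum_congr _ _ (fun k => ?_)
        by_cases hk : k = ks
        · subst hk; simp [W', hα]
        · simp [i', W', Function.update_of_ne hk]
      have hcnt : ∀ j : Fin 5, (univ.filter (fun k => i' k = ord j)).card + (if j = 4 then 1 else 0) =
          (kf (ord j) : ℕ) + (if j = 1 then 1 else 0) := by
        intro j
        have := card_filter_update i ks (ord 1) (ord j)
        rw [hiks] at this
        simp only [eq_comm (a := ord 4), eq_comm (a := ord 1), hjq, hj4] at this
        rw [hkf]; exact this
      rcases hrest with ⟨h0p, -, hc⟩ | ⟨h0q, -, hc⟩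
      · refine four_slices_one_pair i' α W' hW' p q u w hu hw ord (horient p q hpq h0p) (fun j => ?_) H'
        have e := hcnt j; have c := hc j
        omega
      · refine four_slices_one_pair i' α W' hW' q p u w hu' hw' ord (horient q p hpq.symm h0q) (fun j => ?_) H'
        have e := hcnt j; have c := hc j
        omega
    · -- genuine bonus at the last slot
      obtain ⟨c₀, hc₀⟩ : ∃ c, α ks c ≠ 0 := by
        by_contra h; push Not at h; exact hα (funext h)
      rcases hrest with ⟨h0p, hmid, -⟩ | ⟨h0q, hmid, -⟩
      · refine four_slices_one_pair_basis i α W hW p q u w hu hw ord (horient p q hpq h0p) c₀ hnone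
          (fun j hj => ?_) H
        by_cases hj4' : (j : ℕ) < 4
        · left; rw [← hkf]; exact hmid j hj hj4'
        · have hj : j = 4 := Fin.ext (by have := j.isLt; omega)
          subst hj
          right
          refine ⟨?_, ks, hiks, hc₀⟩
          rw [hone, if_neg h4q]
          decide
      · refine four_slices_one_pair_basis i α W hW q p u w hu' hw' ord (horient q p hpq.symm h0q) c₀ hnone
          (fun j hj => ?_) H
        by_cases hj4' : (j : ℕ) < 4
        · left; rw [← hkf]; exact hmid j hj hj4'
        · have hj : j = 4 := Fin.ext (by have := j.isLt; omega)
          subst hj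
          right
          refine ⟨?_, ks, hiks, hc₀⟩
          rw [hone, if_neg h4p]
          decide

end LaplaceFiveSlices

end Summit.ValiantsHypothesis.ValiantsHypothesis.Theorems.RigidityForcesSymmetryRankRigidMinimalRepr
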